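import Literature.AlgebraicGeometry.HodgeTheory.ProjectiveSubquotientHilbertFunction
import Literature.Algebra.Homology.LaurentCechSaturatedSubmodules
import Literature.Algebra.Homology.LaurentCechSaturationInvariance
import Literature.Algebra.Homology.LaurentCechGradedSubquotient
import HarnessLib

/-!
# `(N' ⧸ N)~ = 0 ⟺ N' ⊆ N̄ ⟺ M_n = 0 for n ≫ 0 ⟺ P_{N'⧸N} = 0`: when is a subquotient sheaf zero?

Hartshorne, *Algebraic Geometry*, II Ex. 5.9: two (quasi-)finitely generated graded `S`-modules
define the same coherent sheaf on `Proj S` iff they agree in all large degrees (`M ≈ M'`), and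
`M ↦ M~` is an equivalence modulo `≈`; II Ex. 5.10: the saturation `N̄` of a submodule and
"`I~ = I'~ ⟺ Ī = Ī'`". In particular **`M~ = 0` iff `M_n = 0` for all `n ≫ 0`**, and for a
subquotient `M = N' ⧸ N` of a free graded module `F_e` (`N ≤ N' ⊆ F_e`) this says `N' ⊆ N̄`.

In the tree's Čech language (`Literature.Algebra.Homology.LaurentCech*`; the sheaf `(N' ⧸ N)~(d)`
on the standard cover of `ℙ^r_A` IS the complex `LaurentCech.subquot e N N' h d`, e.g. an ideal sheaf
`𝓘_{Z ⊂ X}`) this file proves, for every commutative ring `A` and finite `J`: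

* `LaurentCech.isZero_subquot_of_le_sat` — `N' ⊆ N̄ ⇒ Č_d(N' ⧸ N) = 0` for every twist `d`
  (saturation invariance `LaurentCechSaturationInvariance.isIso_inclusion_of_le_saturation`);
* **`LaurentCech.le_sat_of_isZero_subquot_zero`** — conversely `Č_0(N' ⧸ N) = 0 ⇒ N' ⊆ N̄` for `N'`
  graded (the vertex terms of `Č_0` are the chart modules `((N')_{x_i})_0`, and
  `N' ⊆ N̄ ⟺ ((N')_{x_i})_0 ⊆ (N_{x_i})_0 ∀ i`, `LaurentCechSaturatedSubmodules`); hence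
  **`LaurentCech.forall_isZero_subquot_iff_le_sat`**, `LaurentCech.isZero_subquot_zero_iff_forall` —
  the subquotient sheaf vanishes iff its degree-`0` twist does iff `N' ⊆ N̄`;
* `LaurentCech.mem_of_isHomog_of_degPiece_le`, **`LaurentCech.le_sat_of_forall_degPiece_le`** —
  `N'_n ⊆ N_n` for all `n ≥ n₀` (`N'` graded) forces `N' ⊆ N̄` (II Ex. 5.9: `M_n = 0` for `n ≫ 0`
  ⇒ `M~ = 0`);

and over a field `k` (`r ≥ 1`, `N ≤ N'` graded), with `Q` the `χ`-polynomial of `N' ⧸ N`: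

* `LaurentCech.degPiece_eq_of_eulerChar_subquot_eq_zero` — `χ(Č_n(N' ⧸ N)) = 0 ∀ n ⇒ N'_n = N_n`
  for `n ≫ 0` (Hilbert–Serre: `dim N'_n - dim N_n = χ` for `n ≫ 0`);
* **`LaurentCech.le_sat_iff_hilbertPolynomial_eq_zero`** — `N' ⊆ N̄ ⟺ Q = 0`;
  **`LaurentCech.forall_isZero_homology_subquot_iff_hilbertPolynomial_eq_zero`** — all
  `H^i(Č_n(N' ⧸ N))` vanish iff `Q = 0`; `LaurentCech.forall_isZero_subquot_iff_hilbertPolynomial_eq_zero`;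
* the quotient case `M = F_e ⧸ K`: `LaurentCech.forall_isZero_quot_iff_top_le_sat`,
  `LaurentCech.top_le_sat_iff_hilbertPolynomial_eq_zero` (`(F_e ⧸ K)~ = 0 ⟺ K̄ = F_e ⟺ P = 0`).

Together with `ProjectiveSubquotientCohomologicalHilbertPolynomials` (Grothendieck: for `Q ≠ 0` the
cohomological dimension of `(N' ⧸ N)~` is `deg Q` and `H^{deg Q}` is non-zero for `n ≪ 0`) this
settles exactly which Čech cohomology modules of a subquotient can be non-zero.

## References

* [Hartshorne1977] R. Hartshorne, *Algebraic Geometry*, GTM 52, Springer 1977: II Prop. 5.15 and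
  Ex. 5.9, Ex. 5.10 (p. 119, 125); I Thm. 7.5 (p. 51); III Ex. 5.2 (p. 230).
* [GortzWedhorn2023] U. Görtz, T. Wedhorn, *Algebraic Geometry II*, Springer 2023, Prop. 23.12 (p. 421).
-/

noncomputable section

open CategoryTheory CategoryTheory.Limits Polynomial

universe u

namespace Literature.Algebra.Homology

namespace LaurentCech

open OrderedCech TopCohomology

/-! ### Any ring: `Č(N' ⧸ N) = 0 ⟺ N' ⊆ N̄ ⟸ N'_n ⊆ N_n (n ≫ 0)` -/

section AnyRing

variable {A : Type u} [CommRing A] {r : ℕ} {J : Type} (e : J → ℤ)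

/-- **`N' ⊆ N̄ ⇒ Č_d(N' ⧸ N) = 0` for every twist `d`**: the inclusion `Č_d(N) ↪ Č_d(N')` is an
isomorphism for `N ≤ N' ≤ N̄` (saturation invariance), so its cokernel vanishes.
[cite: Hartshorne1977, II Ex. 5.10 (p. 125)] -/
theorem isZero_subquot_of_le_sat {N N' : Submodule (P A r) (J → P A r)} (h : N ≤ N')
    (hsat : N' ≤ sat N) (d : ℤ) : IsZero (subquot e N N' h d) := by
  haveI := isIso_inclusion_of_le_saturation e h (le_sat_iff.1 hsat) d
  exact isZero_cokernel_of_epi _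

/-- … hence all its cohomology vanishes. [cite: Hartshorne1977, II Ex. 5.10 (p. 125)] -/
theorem isZero_homology_subquot_of_le_sat {N N' : Submodule (P A r) (J → P A r)} (h : N ≤ N')
    (hsat : N' ≤ sat N) (d i : ℤ) : IsZero ((subquot e N N' h d).homology i) :=
  isZero_homology_of_isZero_X _ i
    ((HomologicalComplex.eval (ModuleCat.{u} A) (ComplexShape.up ℤ) i).map_isZero
      (isZero_subquot_of_le_sat e h hsat d))

/-- **`Č_0(N' ⧸ N) = 0 ⇒ N' ⊆ N̄`** for `N'` graded and `J` finite: if the untwisted Čech complex of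
the subquotient vanishes then `Č_0(N) ↪ Č_0(N')` is onto in cochain degree `0`, i.e. on the vertex
terms `((N')_{x_i})_0`; so `((N')_{x_i})_0 ⊆ (N_{x_i})_0` for every chart `i`, which for graded `N'`
is `N̄' ⊆ N̄` (`sat_le_sat_iff_forall_locDeg_zero_le`, II Ex. 5.10 (b)).
[cite: Hartshorne1977, II Ex. 5.10 (b) (p. 125)] [cite: Hartshorne1977, II Ex. 5.9 (b) (p. 125)] -/
theorem le_sat_of_isZero_subquot_zero [Fintype J] {N N' : Submodule (P A r) (J → P A r)}
    (h : N ≤ N') (hN' : IsGraded e N') (hz : IsZero (subquot e N N' h 0)) : N' ≤ sat N := by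
  classical
  haveI : Epi (inclusion e N N' h 0) := Preadditive.epi_of_isZero_cokernel _ hz
  have hsurj : Function.Surjective ((inclusion e N N' h 0).f 0).hom := by
    rw [← ModuleCat.epi_iff_surjective]
    infer_instance
  refine (le_sat N').trans ((sat_le_sat_iff_forall_locDeg_zero_le e hN').2 fun i => ?_)
  intro v hv
  let σ₀ : Simplex (Fin (r + 1)) 0 :=
    ⟨{i}, Finset.singleton_nonempty i, by rw [Finset.card_singleton]; norm_num⟩
  obtain ⟨y, hy⟩ : ∃ y : (cech e N' 0).X 0,
      (((y : Cochain (fun s => locDeg e N' s 0) 0) σ₀ : locDeg e N' σ₀.1 0) : J → L A r) = v :=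
    ⟨(Pi.single σ₀ (⟨v, hv⟩ : locDeg e N' σ₀.1 0) : Cochain (fun s => locDeg e N' s 0) 0), by
      change ((Pi.single σ₀ (⟨v, hv⟩ : locDeg e N' σ₀.1 0) :
        ∀ σ : Simplex (Fin (r + 1)) 0, locDeg e N' σ.1 0) σ₀ : J → L A r) = v
      rw [Pi.single_eq_same]⟩
  obtain ⟨x, hx⟩ := hsurj y
  have hmem : y ∈ LinearMap.range ((inclusion e N N' h 0).f 0).hom := ⟨x, hx⟩
  rw [mem_range_inclusion_f_iff] at hmem
  have h1 := hmem σ₀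
  rw [hy] at h1
  exact (mem_locDeg _ _).2 ⟨h1, ((mem_locDeg _ _).1 hv).2⟩

/-- **`(N' ⧸ N)~ = 0 ⟺ N' ⊆ N̄`**: the Čech complexes `Č_d(N' ⧸ N)` vanish for all twists `d` iff
`N'` lies in the saturation of `N` (`N'` graded, `J` finite, any ring).
[cite: Hartshorne1977, II Ex. 5.10 (b) (p. 125)] [cite: Hartshorne1977, II Ex. 5.9 (p. 125)] -/
theorem forall_isZero_subquot_iff_le_sat [Fintype J] {N N' : Submodule (P A r) (J → P A r)}
    (h : N ≤ N') (hN' : IsGraded e N') :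
    (∀ d : ℤ, IsZero (subquot e N N' h d)) ↔ N' ≤ sat N :=
  ⟨fun hz => le_sat_of_isZero_subquot_zero e h hN' (hz 0), fun hs d => isZero_subquot_of_le_sat e h hs d⟩

/-- **The subquotient sheaf vanishes iff its untwisted Čech complex does**:
`Č_0(N' ⧸ N) = 0 ⟺ Č_d(N' ⧸ N) = 0 ∀ d`. [cite: Hartshorne1977, II Ex. 5.10 (b) (p. 125)] -/
theorem isZero_subquot_zero_iff_forall [Fintype J] {N N' : Submodule (P A r) (J → P A r)}
    (h : N ≤ N') (hN' : IsGraded e N') :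
    IsZero (subquot e N N' h 0) ↔ ∀ d : ℤ, IsZero (subquot e N N' h d) :=
  ⟨fun hz d => isZero_subquot_of_le_sat e h (le_sat_of_isZero_subquot_zero e h hN' hz) d,
    fun hz => hz 0⟩

/-- The quotient case: **`(F_e ⧸ K)~ = 0 ⟺ K̄ = F_e`** (`Č_d(F_e ⧸ K) = 0 ∀ d ⟺ F_e ⊆ K̄`).
[cite: Hartshorne1977, II Ex. 5.10 (b) (p. 125)] -/
theorem forall_isZero_quot_iff_top_le_sat [Fintype J] (K : Submodule (P A r) (J → P A r)) :
    (∀ d : ℤ, IsZero (quot e K d)) ↔ ⊤ ≤ sat K :=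
  forall_isZero_subquot_iff_le_sat e (le_top : K ≤ ⊤) (isGraded_top e)

/-- A homogeneous `w ∈ N'` of degree `D` with `N'_D ⊆ N_D` lies in `N`.
[cite: Hartshorne1977, II Ex. 5.9 (p. 125)] -/
theorem mem_of_isHomog_of_degPiece_le {N N' : Submodule (P A r) (J → P A r)} {D : ℤ}
    (hle : degPiece e N' D ≤ degPiece e N D) {w : J → P A r} (hw : w ∈ N') (hhom : IsHomog e D w) :
    w ∈ N := by
  have hdeg : ∀ j, toL A r (w j) ∈ Ldeg A r (D - e j) := fun j => by
    have h := (projDeg_eq_self_iff e).1 hhom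
    rw [mem_Kdeg] at h
    have := h j
    rwa [ιK_apply] at this
  obtain ⟨q, hqw⟩ : ∃ q : ∀ j, (Ldeg A r (D - e j)).comap (toL A r).toLinearMap,
      (fun j => (q j : P A r)) = w := ⟨fun j => ⟨w j, hdeg j⟩, rfl⟩
  have hq : q ∈ degPiece e N' D := by rw [mem_degPiece, hqw]; exact hw
  have hq' := hle hq
  rw [mem_degPiece, hqw] at hq'
  exact hq'

/-- **`N'_n ⊆ N_n` for all `n ≥ n₀` forces `N' ⊆ N̄`** (`N'` graded, `J` finite): for `v ∈ N'` and a
chart `i`, `x_i^m v = Σ_d x_i^m v_d` with every `x_i^m v_d ∈ N'` homogeneous of degree `d + m ≥ n₀`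
once `m ≥ n₀ - min deg v`, hence in `N` — II Ex. 5.9: modules agreeing in large degrees define the
same sheaf. [cite: Hartshorne1977, II Ex. 5.9 (b) (p. 125)]
[cite: GortzWedhorn2023, Prop. 23.12 (1) (proof, p. 421)] -/
theorem le_sat_of_forall_degPiece_le [Fintype J] {N N' : Submodule (P A r) (J → P A r)}
    (hN' : IsGraded e N') {n₀ : ℤ} (hle : ∀ n : ℤ, n₀ ≤ n → degPiece e N' n ≤ degPiece e N n) :
    N' ≤ sat N := by
  intro v hv i
  obtain ⟨m, hm⟩ : ∃ m : ℤ, ∀ d ∈ degSet e v, m ≤ d :=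
    ⟨-(∑ d ∈ degSet e v, |d|), fun d hd => by
      have h1 : |d| ≤ ∑ x ∈ degSet e v, |x| :=
        Finset.single_le_sum (f := fun x => |x|) (fun x _ => abs_nonneg x) hd
      have h2 := neg_abs_le d
      omega⟩
  refine ⟨(n₀ - m).toNat, ?_⟩
  rw [← sum_projDeg e v, Finset.smul_sum]
  refine Submodule.sum_mem _ fun d hd => ?_
  have hdn : n₀ ≤ d + ((n₀ - m).toNat : ℤ) := by
    have := Int.self_le_toNat (n₀ - m)
    have := hm d hd
    omega
  refine mem_of_isHomog_of_degPiece_le e (hle _ hdn) (N'.smul_mem _ (hN' d v hv)) ?_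
  rw [IsHomog, projDeg_smul_of_mem_Ldeg e (toL_X_pow_mem_Ldeg i _), add_sub_cancel_right,
    projDeg_projDeg]

/-- Hence `N'_n ⊆ N_n` for `n ≫ 0` kills the subquotient sheaf: `Č_d(N' ⧸ N) = 0` for all `d`.
[cite: Hartshorne1977, II Ex. 5.9 (b) (p. 125)] -/
theorem isZero_subquot_of_forall_degPiece_le [Fintype J] {N N' : Submodule (P A r) (J → P A r)}
    (h : N ≤ N') (hN' : IsGraded e N') {n₀ : ℤ}
    (hle : ∀ n : ℤ, n₀ ≤ n → degPiece e N' n ≤ degPiece e N n) (d : ℤ) :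
    IsZero (subquot e N N' h d) :=
  isZero_subquot_of_le_sat e h (le_sat_of_forall_degPiece_le e hN' hle) d

end AnyRing

/-! ### Over a field: `⟺ P_{N'⧸N} = 0 ⟺` all cohomology vanishes -/

section Field

variable {k : Type u} [Field k] {r : ℕ} {J : Type} [Fintype J] (e : J → ℤ)

/-- **`χ(Č_n(N' ⧸ N)) = 0` for all `n` forces `N'_n = N_n` for `n ≫ 0`** (`k` a field, `r ≥ 1`,
`N ≤ N'` graded): Hilbert–Serre gives `dim N'_n - dim N_n = χ(Č_n(N' ⧸ N))` for `n ≫ 0`.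
[cite: Hartshorne1977, I Thm. 7.5 (p. 51)] [cite: Hartshorne1977, III Ex. 5.2 (p. 230)] -/
theorem degPiece_eq_of_eulerChar_subquot_eq_zero (hr : 1 ≤ r) {N N' : Submodule (P k r) (J → P k r)}
    (hN : IsGraded e N) (hN' : IsGraded e N') (h : N ≤ N')
    (hχ : ∀ n : ℤ, ∑ q ∈ Finset.range (r + 1), (-1 : ℤ) ^ q *
      (Module.finrank k ((subquot e N N' h n).homology q) : ℤ) = 0) :
    ∃ n₀ : ℤ, ∀ n : ℤ, n₀ ≤ n → degPiece e N' n = degPiece e N n := by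
  obtain ⟨n₀, hn₀⟩ := exists_forall_finrank_degPiece_sub_eq_eulerChar_subquot e hr hN hN' h
  refine ⟨n₀, fun n hn => ?_⟩
  haveI : ∀ j, Module.Finite k ((Ldeg k r (n - e j)).comap (toL k r).toLinearMap) := fun j =>
    moduleFinite_comap_toL_Ldeg _
  have hfin := hn₀ n hn
  rw [hχ n] at hfin
  exact (Submodule.eq_of_le_of_finrank_eq (degPiece_mono e h n) (by omega)).symm

/-- **`P_{N'⧸N} ≡ 0 ⇒ N' ⊆ N̄`** (`k` a field, `r ≥ 1`, `N ≤ N'` graded): vanishing Euler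
characteristics force `N'_n = N_n` for `n ≫ 0`, hence `N' ⊆ N̄`.
[cite: Hartshorne1977, II Ex. 5.9 (b) (p. 125)] [cite: Hartshorne1977, I Thm. 7.5 (p. 51)] -/
theorem le_sat_of_eulerChar_subquot_eq_zero (hr : 1 ≤ r) {N N' : Submodule (P k r) (J → P k r)}
    (hN : IsGraded e N) (hN' : IsGraded e N') (h : N ≤ N')
    (hχ : ∀ n : ℤ, ∑ q ∈ Finset.range (r + 1), (-1 : ℤ) ^ q *
      (Module.finrank k ((subquot e N N' h n).homology q) : ℤ) = 0) :
    N' ≤ sat N := by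
  obtain ⟨n₀, hn₀⟩ := degPiece_eq_of_eulerChar_subquot_eq_zero e hr hN hN' h hχ
  exact le_sat_of_forall_degPiece_le e hN' fun n hn => (hn₀ n hn).le

omit [Fintype J] in
/-- Conversely `N' ⊆ N̄ ⇒ χ(Č_n(N' ⧸ N)) = 0` for all `n` (the complexes vanish).
[cite: Hartshorne1977, II Ex. 5.10 (p. 125)] [cite: Hartshorne1977, III Ex. 5.1 (p. 230)] -/
theorem eulerChar_subquot_eq_zero_of_le_sat {N N' : Submodule (P k r) (J → P k r)} (h : N ≤ N')
    (hsat : N' ≤ sat N) (n : ℤ) :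
    ∑ q ∈ Finset.range (r + 1), (-1 : ℤ) ^ q *
      (Module.finrank k ((subquot e N N' h n).homology q) : ℤ) = 0 := by
  refine Finset.sum_eq_zero fun q _ => ?_
  haveI := ModuleCat.subsingleton_of_isZero (isZero_homology_subquot_of_le_sat e h hsat n q)
  rw [Module.finrank_zero_of_subsingleton, Nat.cast_zero, mul_zero]

/-- **`N' ⊆ N̄ ⟺ P_{N'⧸N} = 0`** for the `χ`-polynomial `Q` of the graded subquotient `N' ⧸ N`
(`k` a field, `r ≥ 1`): the subquotient sheaf is zero iff its Hilbert polynomial is.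
[cite: Hartshorne1977, II Ex. 5.9 (b) (p. 125)] [cite: Hartshorne1977, III Ex. 5.2 (p. 230)] -/
theorem le_sat_iff_hilbertPolynomial_eq_zero (hr : 1 ≤ r) {N N' : Submodule (P k r) (J → P k r)}
    (hN : IsGraded e N) (hN' : IsGraded e N') (h : N ≤ N') {Q : ℚ[X]}
    (hQ : ∀ n : ℤ, ((∑ q ∈ Finset.range (r + 1), (-1 : ℤ) ^ q *
      (Module.finrank k ((subquot e N N' h n).homology q) : ℤ) : ℤ) : ℚ) = Q.eval (n : ℚ)) :
    N' ≤ sat N ↔ Q = 0 := by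
  constructor
  · intro hsat
    refine Polynomial.eq_of_forall_intCast_eval_eq_of_le Q 0 0 fun n _ => ?_
    rw [← hQ n, eulerChar_subquot_eq_zero_of_le_sat e h hsat n, Int.cast_zero, eval_zero]
  · intro hQ0
    refine le_sat_of_eulerChar_subquot_eq_zero e hr hN hN' h fun n => ?_
    have := hQ n
    rw [hQ0, eval_zero] at this
    exact_mod_cast this

/-- **`(N' ⧸ N)~ = 0 ⟺ P_{N'⧸N} = 0`**: `Č_d(N' ⧸ N) = 0` for all `d` iff `Q = 0`.
[cite: Hartshorne1977, II Ex. 5.9 (b) (p. 125)] [cite: Hartshorne1977, III Ex. 5.2 (p. 230)] -/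
theorem forall_isZero_subquot_iff_hilbertPolynomial_eq_zero (hr : 1 ≤ r)
    {N N' : Submodule (P k r) (J → P k r)} (hN : IsGraded e N) (hN' : IsGraded e N') (h : N ≤ N')
    {Q : ℚ[X]}
    (hQ : ∀ n : ℤ, ((∑ q ∈ Finset.range (r + 1), (-1 : ℤ) ^ q *
      (Module.finrank k ((subquot e N N' h n).homology q) : ℤ) : ℤ) : ℚ) = Q.eval (n : ℚ)) :
    (∀ d : ℤ, IsZero (subquot e N N' h d)) ↔ Q = 0 := by
  rw [forall_isZero_subquot_iff_le_sat e h hN', le_sat_iff_hilbertPolynomial_eq_zero e hr hN hN' h hQ]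

/-- **All Čech cohomology of `(N' ⧸ N)~` (all twists, all degrees) vanishes iff `P_{N'⧸N} = 0`** —
the complement of Grothendieck's theorem (`ProjectiveSubquotientCohomologicalHilbertPolynomials`:
for `Q ≠ 0`, `H^{deg Q}(Č_n(N' ⧸ N)) ≠ 0` for all `n ≪ 0`).
[cite: Hartshorne1977, II Ex. 5.9 (b) (p. 125)] [cite: Hartshorne1977, III Ex. 5.2 (p. 230)] -/
theorem forall_isZero_homology_subquot_iff_hilbertPolynomial_eq_zero (hr : 1 ≤ r)
    {N N' : Submodule (P k r) (J → P k r)} (hN : IsGraded e N) (hN' : IsGraded e N') (h : N ≤ N')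
    {Q : ℚ[X]}
    (hQ : ∀ n : ℤ, ((∑ q ∈ Finset.range (r + 1), (-1 : ℤ) ^ q *
      (Module.finrank k ((subquot e N N' h n).homology q) : ℤ) : ℤ) : ℚ) = Q.eval (n : ℚ)) :
    (∀ n i : ℤ, IsZero ((subquot e N N' h n).homology i)) ↔ Q = 0 := by
  constructor
  · intro hz
    refine Polynomial.eq_of_forall_intCast_eval_eq_of_le Q 0 0 fun n _ => ?_
    rw [← hQ n, eval_zero]
    have : ∑ q ∈ Finset.range (r + 1), (-1 : ℤ) ^ q *
        (Module.finrank k ((subquot e N N' h n).homology q) : ℤ) = 0 := by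
      refine Finset.sum_eq_zero fun q _ => ?_
      haveI := ModuleCat.subsingleton_of_isZero (hz n q)
      rw [Module.finrank_zero_of_subsingleton, Nat.cast_zero, mul_zero]
    rw [this, Int.cast_zero]
  · intro hQ0 n i
    exact isZero_homology_subquot_of_le_sat e h
      ((le_sat_iff_hilbertPolynomial_eq_zero e hr hN hN' h hQ).2 hQ0) n i

/-- The quotient case: **`(F_e ⧸ K)~ = 0 ⟺ K̄ = F_e ⟺ P_{F_e⧸K} = 0`** (`K` graded).
[cite: Hartshorne1977, II Ex. 5.9 (b) (p. 125)] [cite: Hartshorne1977, II Ex. 5.10 (b) (p. 125)] -/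
theorem top_le_sat_iff_hilbertPolynomial_eq_zero (hr : 1 ≤ r) {K : Submodule (P k r) (J → P k r)}
    (hK : IsGraded e K) {Q : ℚ[X]}
    (hQ : ∀ n : ℤ, ((∑ q ∈ Finset.range (r + 1), (-1 : ℤ) ^ q *
      (Module.finrank k ((quot e K n).homology q) : ℤ) : ℤ) : ℚ) = Q.eval (n : ℚ)) :
    ⊤ ≤ sat K ↔ Q = 0 :=
  le_sat_iff_hilbertPolynomial_eq_zero e hr hK (isGraded_top e) le_top hQ

/-- … and all `H^i(Č_n(F_e ⧸ K))` vanish iff `P_{F_e⧸K} = 0`.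
[cite: Hartshorne1977, II Ex. 5.9 (b) (p. 125)] [cite: Hartshorne1977, III Ex. 5.2 (p. 230)] -/
theorem forall_isZero_homology_quot_iff_hilbertPolynomial_eq_zero (hr : 1 ≤ r)
    {K : Submodule (P k r) (J → P k r)} (hK : IsGraded e K) {Q : ℚ[X]}
    (hQ : ∀ n : ℤ, ((∑ q ∈ Finset.range (r + 1), (-1 : ℤ) ^ q *
      (Module.finrank k ((quot e K n).homology q) : ℤ) : ℤ) : ℚ) = Q.eval (n : ℚ)) :
    (∀ n i : ℤ, IsZero ((quot e K n).homology i)) ↔ Q = 0 :=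
  forall_isZero_homology_subquot_iff_hilbertPolynomial_eq_zero e hr hK (isGraded_top e) le_top hQ

end Field

end LaurentCech

end Literature.Algebra.Homology

end
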